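import Literature.Analysis.FunctionSpaces.BesselIGeneratingFunction
import Mathlib.MeasureTheory.Integral.DominatedConvergence
import Mathlib.Analysis.SpecialFunctions.Integrals.Basic
import HarnessLib

/-!
# The incomplete Bessel integrals `∫ v sin(nv) e^{β cos v}`, `∫ v² cos(nv) e^{β cos v}` as Bessel series

HONEST FRAMING: exact (Metropolis-corrected) sampling algorithms for lattice gauge theory;
figures of merit are autocorrelation/cost numbers at stated couplings and volumes; no
continuum-physics claim.

Venture `LatticeQCDFlow` (cell pub-lqcd), sub-topic `Scoring`; FANOUT row 5 (`s0-sun-a`), GEN-14.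
NEW WORK of the cell (placement rule).  The closed form of the topological susceptibility of 2-d
`U(1)` on the torus (`Scoring/U1TorusTopologicalSusceptibilityBessel.lean`) involves, besides the
complete integrals `∫_{−π}^{π} cos(nv) e^{β cos v} dv = 2π I_{|n|}(β)`, the two period integrals

  `s_n(β) = ∫_{−π}^{π} v sin(nv) e^{β cos v} dv`,  `c_n(β) = ∫_{−π}^{π} v² cos(nv) e^{β cos v} dv`  (`n ∈ ℤ`).

Integrating the Bessel generating function `e^{β cos v} = Σ_{m∈ℤ} I_{|m|}(β) cos(mv)` (the tree's
`hasSum_besselI_natAbs_mul_cos`, DLMF 10.35.2) term by term against `v sin(nv)` and `v² cos(nv)`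
(dominated convergence, `Σ_m |I_{|m|}(β)| = e^{|β|}`) and evaluating the trigonometric moments

  `∫_{−π}^{π} v sin(jv) dv = −2π(−1)^j/j` (`j ≠ 0`; `0` for `j = 0`),
  `∫_{−π}^{π} v² cos(jv) dv = 4π(−1)^j/j²` (`j ≠ 0`), `= 2π³/3` (`j = 0`),

gives absolutely convergent BESSEL SERIES with rational-times-`π` coefficients:

* **`sinMoment_eq_tsum`** — `s_n(β) = −2π Σ_{m∈ℤ} (−1)^{n+m} I_{|m|}(β)/(n+m)` (the term `m = −n` is `0`);
* **`cosMoment_eq_tsum`** — `c_n(β) = (2π³/3) I_{|n|}(β) + 4π Σ_{m∈ℤ} (−1)^{n+m} I_{|m|}(β)/(n+m)²`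

(in Lean `x/0 = 0`, so the sums run over all of `ℤ`).  These make the susceptibility formula a ratio
of explicit Bessel series (`Scoring/U1TorusTopologicalSusceptibilityTwelfth.lean`) and are the input
of its kernel-checked enclosures.  Elementary on top of Mathlib and the tree's Bessel files; nothing
new is cited.
-/

noncomputable section

open MeasureTheory Set Real Filter Topology
open Literature.Analysis.FunctionSpaces

namespace Summit.Ventures.LatticeQCDFlow.Scoring

/-! ### 1. Trigonometric moments over the symmetric period -/

/-- `cos(jπ) = (−1)^j` also at `−π`: `cos(j(−π)) = (−1)^j`. -/
theorem cos_int_mul_neg_pi (j : ℤ) : Real.cos (j * -π) = (-1 : ℝ) ^ j := by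
  rw [mul_neg, Real.cos_neg, Real.cos_int_mul_pi]

/-- `sin(j(±π)) = 0`. -/
theorem sin_int_mul_neg_pi (j : ℤ) : Real.sin (j * -π) = 0 := by
  rw [mul_neg, Real.sin_neg, Real.sin_int_mul_pi, neg_zero]

/-- **`∫_{−π}^{π} v sin(jv) dv = −2π(−1)^j/j`** for every `j ∈ ℤ` (both sides vanish at `j = 0`). -/
theorem integral_id_mul_sin_int (j : ℤ) :
    ∫ v in (-π)..π, v * Real.sin (j * v) = -2 * π * (-1 : ℝ) ^ j / j := by
  rcases eq_or_ne j 0 with rfl | hj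
  · simp
  have hj' : (j : ℝ) ≠ 0 := by exact_mod_cast hj
  -- antiderivative `F(v) = −v cos(jv)/j + sin(jv)/j²`
  have hderiv : ∀ v ∈ uIcc (-π) π, HasDerivAt
      (fun v : ℝ => -v * Real.cos (j * v) / j + Real.sin (j * v) / j ^ 2)
      (v * Real.sin (j * v)) v := by
    intro v _
    have h1 : HasDerivAt (fun v : ℝ => (j : ℝ) * v) (j : ℝ) v := by
      simpa using (hasDerivAt_id v).const_mul (j : ℝ)
    have hc := (Real.hasDerivAt_cos _).comp v h1
    have hs := (Real.hasDerivAt_sin _).comp v h1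
    have h := (((hasDerivAt_neg v).mul hc).div_const (j : ℝ)).add (hs.div_const ((j : ℝ) ^ 2))
    refine h.congr_deriv ?_
    simp only [Function.comp_def]
    field_simp
    ring
  rw [intervalIntegral.integral_eq_sub_of_hasDerivAt hderiv
    ((by fun_prop : Continuous fun v : ℝ => v * Real.sin (j * v)).intervalIntegrable _ _)]
  rw [Real.cos_int_mul_pi, Real.sin_int_mul_pi, cos_int_mul_neg_pi, sin_int_mul_neg_pi]
  field_simp
  ring

/-- **`∫_{−π}^{π} v² cos(jv) dv = 4π(−1)^j/j²`** for `j ≠ 0`. -/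
theorem integral_sq_mul_cos_int {j : ℤ} (hj : j ≠ 0) :
    ∫ v in (-π)..π, v ^ 2 * Real.cos (j * v) = 4 * π * (-1 : ℝ) ^ j / j ^ 2 := by
  have hj' : (j : ℝ) ≠ 0 := by exact_mod_cast hj
  -- antiderivative `G(v) = v² sin(jv)/j + 2v cos(jv)/j² − 2 sin(jv)/j³`
  have hderiv : ∀ v ∈ uIcc (-π) π, HasDerivAt
      (fun v : ℝ => v ^ 2 * Real.sin (j * v) / j + 2 * v * Real.cos (j * v) / j ^ 2 -
        2 * Real.sin (j * v) / j ^ 3)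
      (v ^ 2 * Real.cos (j * v)) v := by
    intro v _
    have h1 : HasDerivAt (fun v : ℝ => (j : ℝ) * v) (j : ℝ) v := by
      simpa using (hasDerivAt_id v).const_mul (j : ℝ)
    have hc := (Real.hasDerivAt_cos _).comp v h1
    have hs := (Real.hasDerivAt_sin _).comp v h1
    have h := ((((hasDerivAt_pow 2 v).mul hs).div_const (j : ℝ)).add
      ((((hasDerivAt_id v).const_mul (2 : ℝ)).mul hc).div_const ((j : ℝ) ^ 2))).sub
      ((hs.const_mul (2 : ℝ)).div_const ((j : ℝ) ^ 3))
    refine h.congr_deriv ?_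
    simp only [Function.comp_def, id]
    field_simp
    ring
  rw [intervalIntegral.integral_eq_sub_of_hasDerivAt hderiv
    ((by fun_prop : Continuous fun v : ℝ => v ^ 2 * Real.cos (j * v)).intervalIntegrable _ _)]
  rw [Real.cos_int_mul_pi, Real.sin_int_mul_pi, cos_int_mul_neg_pi, sin_int_mul_neg_pi]
  field_simp
  ring

/-- `∫_{−π}^{π} v² dv = 2π³/3` (the case `j = 0`). -/
theorem integral_sq_neg_pi_pi : ∫ v in (-π)..π, v ^ 2 = 2 * π ^ 3 / 3 := by
  rw [integral_pow]; ring

/-- The second trigonometric moment for every `j ∈ ℤ`: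
`∫_{−π}^{π} v² cos(jv) dv = [j = 0]·2π³/3 + 4π(−1)^j/j²` (the second term is `0` at `j = 0`). -/
theorem integral_sq_mul_cos_int_eq (j : ℤ) :
    ∫ v in (-π)..π, v ^ 2 * Real.cos (j * v) =
      (if j = 0 then 2 * π ^ 3 / 3 else 0) + 4 * π * (-1 : ℝ) ^ j / j ^ 2 := by
  rcases eq_or_ne j 0 with rfl | hj
  · have h0 : ∫ v in (-π)..π, v ^ 2 * Real.cos (((0 : ℤ) : ℝ) * v) = ∫ v in (-π)..π, v ^ 2 :=
      intervalIntegral.integral_congr fun v _ => by simp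
    rw [if_pos rfl, h0, integral_sq_neg_pi_pi]
    simp
  · rw [if_neg hj, integral_sq_mul_cos_int hj, zero_add]

/-! ### 2. Term-by-term integration of the generating function -/

/-- Dominated term-by-term integration of `e^{β cos v} = Σ_m I_{|m|}(β) cos(mv)` against a continuous
weight `w` on the period: `Σ_m I_{|m|}(β) ∫ w(v) cos(mv) dv = ∫ w(v) e^{β cos v} dv`. -/
theorem hasSum_integral_mul_besselI_cos (β : ℝ) {w : ℝ → ℝ} (hw : Continuous w) :
    HasSum (fun m : ℤ => ∫ v in (-π)..π, w v * (besselI m.natAbs β * Real.cos (m * v)))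
      (∫ v in (-π)..π, w v * Real.exp (β * Real.cos v)) := by
  -- a uniform bound for the weight on the period
  obtain ⟨B, hB⟩ : ∃ B, ∀ v ∈ uIcc (-π) π, |w v| ≤ B := by
    obtain ⟨B, hB⟩ := isCompact_uIcc.exists_bound_of_continuousOn (f := w) hw.continuousOn
    exact ⟨B, fun v hv => by simpa [Real.norm_eq_abs] using hB v hv⟩
  refine intervalIntegral.hasSum_integral_of_dominated_convergence
    (fun m _ => B * |besselI m.natAbs β|) (fun m => ?_) (fun m => ?_) ?_ ?_ ?_
  · exact (hw.mul (continuous_const.mul (Real.continuous_cos.comp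
      (continuous_const.mul continuous_id)))).aestronglyMeasurable
  · refine Eventually.of_forall fun v hv => ?_
    have hv' : v ∈ uIcc (-π) π := uIoc_subset_uIcc hv
    rw [Real.norm_eq_abs, abs_mul, abs_mul]
    calc |w v| * (|besselI m.natAbs β| * |Real.cos (m * v)|)
        ≤ B * (|besselI m.natAbs β| * 1) := by
          refine mul_le_mul (hB v hv') ?_ (by positivity) ?_
          · exact mul_le_mul_of_nonneg_left (Real.abs_cos_le_one _) (abs_nonneg _)
          · exact le_trans (abs_nonneg _) (hB v hv')
      _ = B * |besselI m.natAbs β| := by ring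
  · refine Eventually.of_forall fun v _ => ?_
    refine ((summable_besselI_natAbs |β|).mul_left B).congr fun m => ?_
    rw [abs_besselI_eq_besselI_abs]
  · exact intervalIntegrable_const
  · refine Eventually.of_forall fun v _ => ?_
    exact (hasSum_besselI_natAbs_mul_cos β v).mul_left (w v)

/-- **`s_n(β) = Σ_m I_{|m|}(β) ∫ v sin(nv) cos(mv) dv`**, the inner integral evaluated:
`∫_{−π}^{π} v sin(nv) cos(mv) dv = −π[(−1)^{n+m}/(n+m) + (−1)^{n−m}/(n−m)]`. -/
theorem hasSum_sinMoment (β : ℝ) (n : ℤ) :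
    HasSum (fun m : ℤ => besselI m.natAbs β *
        (-π * ((-1 : ℝ) ^ (n + m) / (n + m : ℤ) + (-1 : ℝ) ^ (n - m) / (n - m : ℤ))))
      (∫ v in (-π)..π, v * Real.sin (n * v) * Real.exp (β * Real.cos v)) := by
  have h := hasSum_integral_mul_besselI_cos β (w := fun v => v * Real.sin (n * v)) (by fun_prop)
  refine h.congr_fun fun m => ?_
  -- `∫ v sin(nv) · (I cos(mv)) = I · ½ (∫ v sin((n+m)v) + ∫ v sin((n−m)v))`
  have hprod : ∀ v : ℝ, v * Real.sin (n * v) * (besselI m.natAbs β * Real.cos (m * v)) =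
      besselI m.natAbs β * ((1 / 2 : ℝ) * (v * Real.sin ((n + m : ℤ) * v)) +
        (1 / 2 : ℝ) * (v * Real.sin ((n - m : ℤ) * v))) := by
    intro v
    push_cast
    rw [add_mul, sub_mul, Real.sin_add, Real.sin_sub]
    ring
  simp_rw [hprod]
  rw [intervalIntegral.integral_const_mul,
    intervalIntegral.integral_add ((by fun_prop : Continuous fun v : ℝ =>
      (1 / 2 : ℝ) * (v * Real.sin ((n + m : ℤ) * v))).intervalIntegrable _ _)
      ((by fun_prop : Continuous fun v : ℝ =>
      (1 / 2 : ℝ) * (v * Real.sin ((n - m : ℤ) * v))).intervalIntegrable _ _),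
    intervalIntegral.integral_const_mul, intervalIntegral.integral_const_mul,
    integral_id_mul_sin_int, integral_id_mul_sin_int]
  ring

/-- **`c_n(β) = Σ_m I_{|m|}(β) ∫ v² cos(nv) cos(mv) dv`**, the inner integral evaluated. -/
theorem hasSum_cosMoment (β : ℝ) (n : ℤ) :
    HasSum (fun m : ℤ => besselI m.natAbs β *
        ((1 / 2 : ℝ) * ((if n + m = 0 then 2 * π ^ 3 / 3 else 0) +
            4 * π * (-1 : ℝ) ^ (n + m) / ((n + m : ℤ) : ℝ) ^ 2) +
          (1 / 2 : ℝ) * ((if n - m = 0 then 2 * π ^ 3 / 3 else 0) +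
            4 * π * (-1 : ℝ) ^ (n - m) / ((n - m : ℤ) : ℝ) ^ 2)))
      (∫ v in (-π)..π, v ^ 2 * Real.cos (n * v) * Real.exp (β * Real.cos v)) := by
  have h := hasSum_integral_mul_besselI_cos β (w := fun v => v ^ 2 * Real.cos (n * v)) (by fun_prop)
  refine h.congr_fun fun m => ?_
  have hprod : ∀ v : ℝ, v ^ 2 * Real.cos (n * v) * (besselI m.natAbs β * Real.cos (m * v)) =
      besselI m.natAbs β * ((1 / 2 : ℝ) * (v ^ 2 * Real.cos ((n + m : ℤ) * v)) +
        (1 / 2 : ℝ) * (v ^ 2 * Real.cos ((n - m : ℤ) * v))) := by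
    intro v
    push_cast
    rw [add_mul, sub_mul, Real.cos_add, Real.cos_sub]
    ring
  simp_rw [hprod]
  rw [intervalIntegral.integral_const_mul,
    intervalIntegral.integral_add ((by fun_prop : Continuous fun v : ℝ =>
      (1 / 2 : ℝ) * (v ^ 2 * Real.cos ((n + m : ℤ) * v))).intervalIntegrable _ _)
      ((by fun_prop : Continuous fun v : ℝ =>
      (1 / 2 : ℝ) * (v ^ 2 * Real.cos ((n - m : ℤ) * v))).intervalIntegrable _ _),
    intervalIntegral.integral_const_mul, intervalIntegral.integral_const_mul,
    integral_sq_mul_cos_int_eq, integral_sq_mul_cos_int_eq]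

/-! ### 3. Symmetrisation `m ↦ −m` and the one-sided series -/

/-- Summability of `m ↦ I_{|m|}(β) a_m` for a bounded sequence `a`. -/
theorem summable_besselI_natAbs_mul_of_bounded (β : ℝ) {a : ℤ → ℝ} {A : ℝ} (ha : ∀ m, |a m| ≤ A) :
    Summable fun m : ℤ => besselI m.natAbs β * a m := by
  refine Summable.of_norm_bounded ((summable_besselI_natAbs |β|).mul_right A) fun m => ?_
  rw [Real.norm_eq_abs, abs_mul, abs_besselI_eq_besselI_abs]
  exact mul_le_mul_of_nonneg_left (ha m) (besselI_nonneg _ (abs_nonneg β))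

/-- `|(−1)^j/j| ≤ 1`. -/
theorem abs_neg_one_zpow_div_le (j : ℤ) : |(-1 : ℝ) ^ j / j| ≤ 1 := by
  rcases eq_or_ne j 0 with rfl | hj
  · simp
  rw [abs_div, abs_neg_one_zpow, one_div]
  refine inv_le_one_of_one_le₀ ?_
  rw [← Int.cast_abs]; exact_mod_cast Int.one_le_abs hj

/-- `|(−1)^j/j²| ≤ 1`. -/
theorem abs_neg_one_zpow_div_sq_le (j : ℤ) : |(-1 : ℝ) ^ j / (j : ℝ) ^ 2| ≤ 1 := by
  rcases eq_or_ne j 0 with rfl | hj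
  · simp
  rw [abs_div, abs_neg_one_zpow, abs_pow, one_div]
  refine inv_le_one_of_one_le₀ ?_
  have h1 : (1 : ℝ) ≤ |(j : ℝ)| := by rw [← Int.cast_abs]; exact_mod_cast Int.one_le_abs hj
  nlinarith

/-- Reflection `m ↦ −m` of the one-sided series: `Σ_m I_{|m|} a(n−m) = Σ_m I_{|m|} a(n+m)`. -/
theorem tsum_besselI_natAbs_mul_reflect (β : ℝ) (a : ℤ → ℝ) (n : ℤ) :
    ∑' m : ℤ, besselI m.natAbs β * a (n - m) = ∑' m : ℤ, besselI m.natAbs β * a (n + m) := by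
  rw [← (Equiv.neg ℤ).tsum_eq]
  refine tsum_congr fun m => ?_
  simp [sub_eq_add_neg]

/-- **THE FIRST INCOMPLETE BESSEL INTEGRAL AS A BESSEL SERIES.**  For every real `β` and `n ∈ ℤ`:
`∫_{−π}^{π} v sin(nv) e^{β cos v} dv = −2π Σ_{m∈ℤ} (−1)^{n+m} I_{|m|}(β)/(n+m)`
(absolutely convergent; the term `m = −n` reads `0`). -/
theorem sinMoment_eq_tsum (β : ℝ) (n : ℤ) :
    ∫ v in (-π)..π, v * Real.sin (n * v) * Real.exp (β * Real.cos v) =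
      -2 * π * ∑' m : ℤ, besselI m.natAbs β * ((-1 : ℝ) ^ (n + m) / (n + m : ℤ)) := by
  rw [← (hasSum_sinMoment β n).tsum_eq]
  have hs1 : Summable fun m : ℤ => besselI m.natAbs β * ((-1 : ℝ) ^ (n + m) / (n + m : ℤ)) :=
    summable_besselI_natAbs_mul_of_bounded β fun m => abs_neg_one_zpow_div_le (n + m)
  have hs2 : Summable fun m : ℤ => besselI m.natAbs β * ((-1 : ℝ) ^ (n - m) / (n - m : ℤ)) :=
    summable_besselI_natAbs_mul_of_bounded β fun m => abs_neg_one_zpow_div_le (n - m)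
  have hsplit : ∀ m : ℤ, besselI m.natAbs β *
      (-π * ((-1 : ℝ) ^ (n + m) / (n + m : ℤ) + (-1 : ℝ) ^ (n - m) / (n - m : ℤ))) =
      -π * (besselI m.natAbs β * ((-1 : ℝ) ^ (n + m) / (n + m : ℤ))) +
        -π * (besselI m.natAbs β * ((-1 : ℝ) ^ (n - m) / (n - m : ℤ))) := fun m => by ring
  simp_rw [hsplit]
  rw [Summable.tsum_add (hs1.mul_left _) (hs2.mul_left _), tsum_mul_left, tsum_mul_left,
    tsum_besselI_natAbs_mul_reflect β (fun j => (-1 : ℝ) ^ j / (j : ℝ)) n]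
  push_cast
  ring

/-- **THE SECOND INCOMPLETE BESSEL INTEGRAL AS A BESSEL SERIES.**  For every real `β` and `n ∈ ℤ`:
`∫_{−π}^{π} v² cos(nv) e^{β cos v} dv = (2π³/3) I_{|n|}(β) + 4π Σ_{m∈ℤ} (−1)^{n+m} I_{|m|}(β)/(n+m)²`
(the term `m = −n` of the series reads `0`). -/
theorem cosMoment_eq_tsum (β : ℝ) (n : ℤ) :
    ∫ v in (-π)..π, v ^ 2 * Real.cos (n * v) * Real.exp (β * Real.cos v) =
      2 * π ^ 3 / 3 * besselI n.natAbs β +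
        4 * π * ∑' m : ℤ, besselI m.natAbs β * ((-1 : ℝ) ^ (n + m) / ((n + m : ℤ) : ℝ) ^ 2) := by
  rw [← (hasSum_cosMoment β n).tsum_eq]
  -- the four pieces
  have hd1 : Summable fun m : ℤ => besselI m.natAbs β * (if n + m = 0 then 2 * π ^ 3 / 3 else 0) := by
    refine summable_of_ne_finset_zero (s := {-n}) fun m hm => ?_
    rw [Finset.mem_singleton] at hm
    rw [if_neg (by omega), mul_zero]
  have hd2 : Summable fun m : ℤ => besselI m.natAbs β * (if n - m = 0 then 2 * π ^ 3 / 3 else 0) := by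
    refine summable_of_ne_finset_zero (s := {n}) fun m hm => ?_
    rw [Finset.mem_singleton] at hm
    rw [if_neg (by omega), mul_zero]
  have hs1 : Summable fun m : ℤ => besselI m.natAbs β * ((-1 : ℝ) ^ (n + m) / ((n + m : ℤ) : ℝ) ^ 2) :=
    summable_besselI_natAbs_mul_of_bounded β fun m => abs_neg_one_zpow_div_sq_le (n + m)
  have hs2 : Summable fun m : ℤ => besselI m.natAbs β * ((-1 : ℝ) ^ (n - m) / ((n - m : ℤ) : ℝ) ^ 2) :=
    summable_besselI_natAbs_mul_of_bounded β fun m => abs_neg_one_zpow_div_sq_le (n - m)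
  -- the delta sums
  have hδ1 : ∑' m : ℤ, besselI m.natAbs β * (if n + m = 0 then 2 * π ^ 3 / 3 else 0) =
      2 * π ^ 3 / 3 * besselI n.natAbs β := by
    rw [tsum_eq_single (-n) fun m hm => by rw [if_neg (by omega), mul_zero]]
    rw [if_pos (by omega), Int.natAbs_neg]
    ring
  have hδ2 : ∑' m : ℤ, besselI m.natAbs β * (if n - m = 0 then 2 * π ^ 3 / 3 else 0) =
      2 * π ^ 3 / 3 * besselI n.natAbs β := by
    rw [tsum_eq_single n fun m hm => by rw [if_neg (by omega), mul_zero]]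
    rw [if_pos (by omega)]
    ring
  have hsplit : ∀ m : ℤ, besselI m.natAbs β *
      ((1 / 2 : ℝ) * ((if n + m = 0 then 2 * π ^ 3 / 3 else 0) +
          4 * π * (-1 : ℝ) ^ (n + m) / ((n + m : ℤ) : ℝ) ^ 2) +
        (1 / 2 : ℝ) * ((if n - m = 0 then 2 * π ^ 3 / 3 else 0) +
          4 * π * (-1 : ℝ) ^ (n - m) / ((n - m : ℤ) : ℝ) ^ 2)) =
      ((1 / 2 : ℝ) * (besselI m.natAbs β * (if n + m = 0 then 2 * π ^ 3 / 3 else 0)) +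
        (1 / 2 : ℝ) * (besselI m.natAbs β * (if n - m = 0 then 2 * π ^ 3 / 3 else 0))) +
      ((2 * π) * (besselI m.natAbs β * ((-1 : ℝ) ^ (n + m) / ((n + m : ℤ) : ℝ) ^ 2)) +
        (2 * π) * (besselI m.natAbs β * ((-1 : ℝ) ^ (n - m) / ((n - m : ℤ) : ℝ) ^ 2))) :=
    fun m => by ring
  simp_rw [hsplit]
  rw [Summable.tsum_add ((hd1.mul_left _).add (hd2.mul_left _)) ((hs1.mul_left _).add (hs2.mul_left _)),
    Summable.tsum_add (hd1.mul_left _) (hd2.mul_left _),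
    Summable.tsum_add (hs1.mul_left _) (hs2.mul_left _),
    tsum_mul_left, tsum_mul_left, tsum_mul_left, tsum_mul_left, hδ1, hδ2,
    tsum_besselI_natAbs_mul_reflect β (fun j => (-1 : ℝ) ^ j / (j : ℝ) ^ 2) n]
  ring

end Summit.Ventures.LatticeQCDFlow.Scoring
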